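import Literature.MathematicalPhysics.QuantumFieldTheory.Balaban1983to89.Node00.TorusCoverLandau153Box

/-!
# NODE 00 — THE (153) DOOR OF [Balaban1985Variational] AT EVERY KERNEL-FINER FAMILY `D′`: `R_{D′} ∂*a = 0` whenever `N(Q′_{D′}) ⊆ N(Q′_{cubeDomains})`, in particular at
# the BOUNDARY-DATUM family of print's (150) *«Ω′_j = □_j, j = 0, …, k − 1, Ω′_k = □″_k»* = the levelwise meet `□_j ∩ Ω_j` of the datum's cube tower with the record's
# family — by the NESTING of [Balaban1984PropagatorsII] (2.12)'s orthogonal projections `R` onto `ΔN(Q′)`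

Cell `pub-ymgap`, width seat `pub-ymgap-dag-n07-w3` generation 5, CLAIM-1 ∕ INTENT-1 (cell INBOX 2026-08-28).  NEW leaf, PROOF kind (no `def`, no `instance`, no `notation`).
CONSUMED BY NAME, nothing modified: generation 3's `Node00.TorusCoverLandau153Box` (`exists_localGauge152_153_box_of_gaugedBoundB8` — the six clauses on the box window with
the sixth-conjunct lift `h6` —, `add_e∕sub_e_mem_box_of_…`), generation 2's `Node00.TorusCoverLandau153RE` (`RE_dsE_re∕im_eq_zero_of_cubeDomains`), generation 0's print road for
[6] Prop. 6 on print's class (`prop6Printed_zdCubP_iff`, `inAk_zdLift_of_top`, `tol_of_level_pred`, `isPrint_propCubeP`); dag-n07-e's `propCubeP` ∕ `cubeIdxP'` (36a) and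
`cubeDomains` (39); N05's `CubeB8` ∕ `GaugedBoundB8`; lit-balaban p21's `B6SectAOperatorsV1` (`RE`, `KE`, `QpE`, `dsE`, `lapE`, `RE_eq_zero_iff`, `mem_ker_QpE_iff`) and
`B6SectADomainsV1` (`Domains`, `InGauge`); r15's `cover`.  `--kind proof --supports stmt-QuantumFields-20542` (K1⁷; count-neutral).
[15] = [Balaban1985Variational]; [6] = [Balaban1985RegularSpaces]; [B6] = [Balaban1984PropagatorsII].

WHY (the located point of the S6 head `pub-ymgap-dag-n07-w4`, cell INBOX 2026-08-28 «ERRATUM (c)»; lane owner `pub-ymgap-dag-n07-e` «ANSWER Q-CUBE-TOP (ii)»).  [15] p. 301: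
*«U′_k … is a minimum in (150), because this space is defined by more restrictive functional conditions»* and (152)–(153) *«on Ω′_j, j = 0, …, k; R∂^{η*}A = 0, where the
operator R is defined for the sequence {Ω′_j}»*.  At an INTERIOR datum `Ω′_j = □_j` is the datum's own tower `cubeDomains` (dag-n07-e 39) and generations 2–3 of this seat
deliver `RE (cubeDomains …) η⁻¹ (dsE η⁻¹ a) = 0`; at a BOUNDARY datum (print's big cube meets `Ω_k` without lying in it) the family of the heart and of (153) is the levelwise
meet `Ω′_j = □_j ∩ Ω_j` — a family `D′` with `D′.Om j ⊆ (cubeDomains …).Om j` for every `j`.  Such a family has MORE vanishing-average constraints on a gauge function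
([B6] (2.7): `λ = 0 on Λ₀, Q′_jλ = 0 on Λ_j`; lit-balaban's `inGauge_iff_forall_not_deep`), hence FEWER gauge test functions: `N(Q′_{D′}) ⊆ N(Q′_{cube})`,
`ΔN(Q′_{D′}) ⊆ ΔN(Q′_{cube})`, and the projections of (2.12) are nested — `R_{cube}v = 0 ⇔ v ⊥ ΔN(Q′_{cube}) ⟹ v ⊥ ΔN(Q′_{D′}) ⇔ R_{D′}v = 0`.  So print's (153) for the
family `{Ω′_j}` holds for the SAME potential `A` that [6] Thm 2 ∕ Prop. 6 on the CUBE tower (1.131) produce: no second application of [6] and no new member datum.  This file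
writes that line (§1, in p21's letters, hypotheses in KERNEL form `ker Q′_{D′} ≤ ker Q′_D` — the output letter of dag-n07-e's `Node00.DomainsRefinement.ker_QpE_le_of_domainsLe` ∘
`Node00.DomainsMeet.domainsMeet_le_left` (INTENT-44, pending at the time of writing), which are NOT restated here), re-reads generation 2's two (153) conclusions at `D′` (§2), and re-issues generation 3's three capstones with the sixth clause quantified over EVERY kernel-finer `D′`, the
gauge `u` and the potential `A` being chosen before `D′` (§3).  Interior datums: `D′ := cubeDomains …`, `le_rfl`.

HONEST FRAMING: count-neutral kernel-lane corollaries (one inclusion of finite-dimensional subspaces + instantiation by name); [6] Proposition 6 at the member ∕ on print's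
class is a HYPOTHESIS (`hG` ∕ `hP6`) throughout, applied to the CUBE datum only — never asserted here; the kernel inclusion `ker Q′_{D′} ≤ ker Q′_{cube}` is a HYPOTHESIS
(its inhabitant at the meet family is dag-n07-e's `Node00.DomainsRefinement` ∕ `Node00.DomainsMeet`, not this file); the non-wrapping of `□₀`, the collar `hcollar` and the `2π`-window are DISPLAYED; nothing
of [15] ∕ [6] ∕ [B6] analysis asserted; tokens NOT discharged; N07 ∕ N05 ∕ K0⁷ ∕ K1⁷ NOT closed or discharged; counts unmoved (typed 28∕28 · discharged 5∕27); one finite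
𝕋⁴ programme at fixed ε — R4 closes the conditional finite-𝕋⁴ rung `BalabanLadder.UV` only; the YM mass gap (Clay) is NOT proved by any of this; nothing continuum ∕ ℝ⁴ ∕
infinite volume ∕ OS.  No `sorry`, no `def`, no `instance`, no `notation`.
-/

noncomputable section

namespace Literature.MathematicalPhysics.QuantumFieldTheory.Balaban1983to89.Node00

open scoped Matrix.Norms.L2Operator InnerProductSpace RealInnerProductSpace
open B7Prop2Explicit (unitaryUnits)
open B8Ineq132 (InAk)
open B8Eq131Cubes (box cube bLo bHi)
open B8Eq138LandauZd (IsLandau138)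
open B15Eq112TorusCover (cover)
open B14DomainGeom (Pt)
open B12RegularSpaces111 (gaugeU expI grad)
open B6SectADomainsV1 (Domains)
open B6SectAOperatorsV1 (ScalarSpace RE KE QpE dsE lapE RE_eq_zero_iff mem_ker_QpE_iff)
open BalabanImbrieJaffe1984to88.BIJ85AxialPropagator411 (BondSpace)
open B8LeafModelZd (ZdIdx)

variable {P : Params} {N : ℕ}

/-! ## §1  [B6] (2.10)–(2.12): the projections `R` onto `ΔN(Q′)` are NESTED along `N(Q′_{D′}) ⊆ N(Q′_D)` -/

section Nesting

/-- **Functional form ⟹ kernel form.**  If every gauge function of the family `D′` ([B6] (2.7): *«λ = 0 on Λ₀, Q′_jλ = 0 on Λ_j»*) is a gauge function of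
the family `D`, then `N(Q′_{D′}) = ker Q′_{D′} ≤ ker Q′_D = N(Q′_D)` as submodules of `L²(T_η)` (p21's `mem_ker_QpE_iff` both ways).
[cite: Balaban1984PropagatorsII, (2.7) p.224, (2.10) p.225] -/
theorem ker_QpE_le_of_forall_inGauge {D D' : Domains P} (h : ∀ f : SiteField P 0 ℝ, D'.InGauge f → D.InGauge f) :
    LinearMap.ker (QpE D') ≤ LinearMap.ker (QpE D) := fun f hf =>
  (mem_ker_QpE_iff D f).2 (h _ ((mem_ker_QpE_iff D' f).1 hf))

/-- **`ΔN(Q′)` is monotone in `N(Q′)`**: `ker Q′_{D′} ≤ ker Q′_D ⟹ ΔN(Q′_{D′}) ≤ ΔN(Q′_D)`. [cite: Balaban1984PropagatorsII, (2.10) p.225] -/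
theorem KE_le_of_ker_le {D D' : Domains P} (h : LinearMap.ker (QpE D') ≤ LinearMap.ker (QpE D)) (c : ℝ) : KE D' c ≤ KE D c :=
  Submodule.map_mono h

/-- ★★ **THE PROJECTIONS OF (2.12) ARE NESTED**: if `N(Q′_{D′}) ⊆ N(Q′_D)` then `R_D v = 0 ⟹ R_{D′} v = 0` — `R_D v = 0` says `v ⊥ ΔN(Q′_D)` ((2.12) read on test
functions, p21's `RE_eq_zero_iff`: `⟨Δμ, v⟩ = 0` for all `μ ∈ N(Q′_D)`), and `ΔN(Q′_{D′}) ⊆ ΔN(Q′_D)`.  The boundary-datum case of [15] (150)–(153): a family with MORE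
vanishing-average constraints (*«more restrictive functional conditions»*, p. 301) has FEWER gauge test functions, so the Landau condition `R ∂*A = 0` persists for the same `A`.
[cite: Balaban1984PropagatorsII, (2.10)–(2.12) p.225, (2.9) p.224; Balaban1985Variational, (150)–(153) p.301] -/
theorem RE_eq_zero_of_ker_le {D D' : Domains P} (h : LinearMap.ker (QpE D') ≤ LinearMap.ker (QpE D)) {c : ℝ} {v : ScalarSpace P}
    (hv : RE D c v = 0) : RE D' c v = 0 :=
  (RE_eq_zero_iff D' c v).2 fun n hn => (RE_eq_zero_iff D c v).1 hv n (h hn)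

/-- The same from the functional form of the inclusion. [cite: Balaban1984PropagatorsII, (2.7) p.224, (2.12) p.225] -/
theorem RE_eq_zero_of_forall_inGauge {D D' : Domains P} (h : ∀ f : SiteField P 0 ℝ, D'.InGauge f → D.InGauge f) {c : ℝ} {v : ScalarSpace P}
    (hv : RE D c v = 0) : RE D' c v = 0 :=
  RE_eq_zero_of_ker_le (ker_QpE_le_of_forall_inGauge h) hv

/-- **Nested projections compose**: `R_{D′} ∘ R_D = R_{D′}` when `N(Q′_{D′}) ⊆ N(Q′_D)` (`v − R_D v ⊥ ΔN(Q′_D) ⊇ ΔN(Q′_{D′})`).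
[cite: Balaban1984PropagatorsII, (2.10)–(2.12) p.225] -/
theorem RE_apply_RE_of_ker_le {D D' : Domains P} (h : LinearMap.ker (QpE D') ≤ LinearMap.ker (QpE D)) (c : ℝ) (v : ScalarSpace P) :
    RE D' c (RE D c v) = RE D' c v := by
  have h0 : RE D' c (v - RE D c v) = 0 := by
    rw [B6SectAOperatorsV1.RE_apply, Submodule.starProjection_apply_eq_zero_iff]
    exact Submodule.orthogonal_le (KE_le_of_ker_le h c) ((KE D c).sub_starProjection_mem_orthogonal v)
  rw [map_sub, sub_eq_zero] at h0
  exact h0.symm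

end Nesting

/-! ## §2  ★★ The door's (153) conclusion at every kernel-finer family `D′` -/

section DoorFiner

/-- ★★ **[15] (153) AT A KERNEL-FINER FAMILY, REAL PART**: generation 2's `RE_dsE_re_eq_zero_of_cubeDomains` (hypotheses byte for byte: a `CubeB8` datum `c`, `c.k ≤ m + K`,
`□₀` non-wrapping, the sixth-conjunct lift «`∃ A′`, `A ⟨π x, μ⟩ = A′ x μ` on `□₀` ∧ `IsLandau138 L c.k η □₀ c.lamS 1 A′`») read at ANY family `D′` of the same torus with
`ker Q′_{D′} ≤ ker Q′_{cubeDomains c}` — e.g. the boundary-datum meet `□_j ∩ Ω_j` of (150): `R_{D′} ∂*a = 0` for `a = Re(φ ∘ A)`, `R_{D′} = RE D′ η⁻¹`, `∂* = dsE η⁻¹`.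
[cite: Balaban1985Variational, (150)–(153) p.301; Balaban1985RegularSpaces, (1.38) p.82; Balaban1984PropagatorsII, (2.7) p.224, (2.10)–(2.12) p.225] -/
theorem RE_dsE_re_eq_zero_of_ker_le_cubeDomains {K' : ℕ} {Ω' : ℕ → Set (B7Prop1Explicit.Site P.d)} (c : CubeB8 P.d P.L K' Ω')
    (hck : c.k ≤ P.m + P.K) (hinj : Set.InjOn (cover P) (c.sq 0)) {η : ℝ} {A : PBond P 0 → MatA N}
    (h6 : ∃ A' : B7Prop1Explicit.Site P.d → Fin P.d → MatA N,
        (∀ x, x ∈ c.sq 0 → ∀ μ, A ⟨cover P x, μ⟩ = A' x μ) ∧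
        IsLandau138 P.L c.k η (c.sq 0) c.lamS (1 : B7Prop1Explicit.Site P.d → Fin P.d → (MatA N)ˣ) A')
    {D' : Domains P} (hD' : LinearMap.ker (QpE D') ≤ LinearMap.ker (QpE (cubeDomains P c.a c.M c.ρ c.k hck)))
    (φ : MatA N →L[ℂ] ℂ) :
    RE D' η⁻¹ (dsE η⁻¹ (WithLp.toLp 2 fun b => (φ (A b)).re : BondSpace P)) = 0 :=
  RE_eq_zero_of_ker_le hD' (RE_dsE_re_eq_zero_of_cubeDomains c hck hinj h6 φ)

/-- ★★ **The same, IMAGINARY PART** (`a = Im(φ ∘ A)`). [cite: Balaban1985Variational, (150)–(153) p.301; Balaban1984PropagatorsII, (2.7) p.224, (2.12) p.225] -/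
theorem RE_dsE_im_eq_zero_of_ker_le_cubeDomains {K' : ℕ} {Ω' : ℕ → Set (B7Prop1Explicit.Site P.d)} (c : CubeB8 P.d P.L K' Ω')
    (hck : c.k ≤ P.m + P.K) (hinj : Set.InjOn (cover P) (c.sq 0)) {η : ℝ} {A : PBond P 0 → MatA N}
    (h6 : ∃ A' : B7Prop1Explicit.Site P.d → Fin P.d → MatA N,
        (∀ x, x ∈ c.sq 0 → ∀ μ, A ⟨cover P x, μ⟩ = A' x μ) ∧
        IsLandau138 P.L c.k η (c.sq 0) c.lamS (1 : B7Prop1Explicit.Site P.d → Fin P.d → (MatA N)ˣ) A')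
    {D' : Domains P} (hD' : LinearMap.ker (QpE D') ≤ LinearMap.ker (QpE (cubeDomains P c.a c.M c.ρ c.k hck)))
    (φ : MatA N →L[ℂ] ℂ) :
    RE D' η⁻¹ (dsE η⁻¹ (WithLp.toLp 2 fun b => (φ (A b)).im : BondSpace P)) = 0 :=
  RE_eq_zero_of_ker_le hD' (RE_dsE_im_eq_zero_of_cubeDomains c hck hinj h6 φ)

end DoorFiner

/-! ## §3  The capstones with the sixth clause over EVERY kernel-finer family (`u`, `A` chosen before `D′`) -/

section Capstones

variable [NeZero N]

/-- ★★ **[6] PROPOSITION 6 AT NODE 00's `ℤᵈ` MEMBER ⟹ THE LOCAL GAUGE OF [15] (152) ON THE BOX WINDOW `π(□)` WITH ITS FOUR LETTERS, AND (153) `R_{D′} ∂*a = 0` AT EVERY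
KERNEL-FINER FAMILY `D′`** — generation 3's `exists_localGauge152_RE153_box_of_gaugedBoundB8` (same hypotheses BYTE FOR BYTE: `d ≥ 2`; `CubeB8` datum `c`, `c.k = n ≤ m + K`,
`Set.InjOn (cover P) (c.sq 0)`; `0 ≤ r`, `GaugedBoundB8 L η_n (zdLift N U) c r` (the HYPOTHESIS); the `2π`-window) with the last conjunct quantified over every `D′ : Domains P`
with `ker Q′_{D′} ≤ ker Q′_{cubeDomains c}`: `RE D′ η_n⁻¹ (dsE η_n⁻¹ a) = 0` for `a = Re ∕ Im(φ∘A)` — ONE gauge `u` and ONE potential `A` for all such families.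
[cite: Balaban1985Variational, (144)–(153) pp.300–301; Balaban1985RegularSpaces, Prop. 6 (1.135)–(1.138) p.99, (1.38) p.82, (1.131) p.99; Balaban1984PropagatorsII, (2.7) p.224, (2.10)–(2.12) p.225; Balaban1987RG1, (0.1) p.251] -/
theorem exists_localGauge152_REfiner153_box_of_gaugedBoundB8 (hd : 2 ≤ P.d) {K' : ℕ} {Ω' : ℕ → Set (B7Prop1Explicit.Site P.d)} (c : CubeB8 P.d P.L K' Ω')
    (U : GaugeField P 0 (SU N)) {n : ℕ} (hk : c.k = n) (hn : n ≤ P.m + P.K) (hinj : Set.InjOn (cover P) (c.sq 0)) {r : ℝ} (hr : 0 ≤ r)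
    (hG : letI : CStarAlgebra (MatA N) := {}; GaugedBoundB8 P.L (P.eta n) (zdLift N U) c r)
    (h2π : (2 * boxWidth (bLo P.L c.a c.k 0) (bHi P.L c.a c.M c.k 0) + 1) * (P.eta n * N * (r * ((P.L : ℝ) ^ c.k * P.eta n)⁻¹)) < 2 * Real.pi) :
    ∃ u : GaugeTransf P 0 (SU N), ∃ A : PBond P 0 → MatA N,
      (∀ b ∈ (Sect2.regionOfSet P (cover P '' box P.L c.a c.M c.k)).bonds, gaugeU (fun x => ιSU N (u x)) (fun b' => ιSU N (U b')) b = expI (P.eta n) (A b)) ∧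
      (∀ b ∈ (Sect2.regionOfSet P (cover P '' box P.L c.a c.M c.k)).bonds, ‖A b‖ ≤ 2 * r) ∧
      (∀ q ∈ (Sect2.regionOfSet P (cover P '' box P.L c.a c.M c.k)).dpairs, ‖grad (P.eta n) q.2.1 (fun y => A ⟨y, q.2.2⟩) q.1‖ ≤ 2 * r) ∧
      (∀ b ∈ Sect2.bondsDeep (cover P '' box P.L c.a c.M c.k), ‖Sect2.codiffCurlA (P.eta n) A b.src b.dir‖ ≤ 2 * r) ∧
      (∀ b ∈ Sect2.bondsDeep (cover P '' box P.L c.a c.M c.k),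
          ‖∑ ν : Fin P.d, ((P.eta n : ℝ) : ℂ)⁻¹ •
              (grad (P.eta n) ν (fun y => A ⟨y, b.dir⟩) (b.src.unshift ν) - grad (P.eta n) ν (fun y => A ⟨y, b.dir⟩) b.src)‖ ≤ 2 * r) ∧
      (∀ D' : Domains P, LinearMap.ker (QpE D') ≤ LinearMap.ker (QpE (cubeDomains P c.a c.M c.ρ c.k (hk ▸ hn))) →
        ∀ φ : MatA N →L[ℂ] ℂ,
          RE D' (P.eta n)⁻¹ (dsE (P.eta n)⁻¹ (WithLp.toLp 2 fun b => (φ (A b)).re : BondSpace P)) = 0 ∧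
          RE D' (P.eta n)⁻¹ (dsE (P.eta n)⁻¹ (WithLp.toLp 2 fun b => (φ (A b)).im : BondSpace P)) = 0) := by
  obtain ⟨u, A, h1, h2, h3, h4, h5, h6⟩ := exists_localGauge152_153_box_of_gaugedBoundB8 hd c U hk hinj hr hG h2π
  exact ⟨u, A, h1, h2, h3, h4, h5, fun D' hD' φ =>
    ⟨RE_dsE_re_eq_zero_of_ker_le_cubeDomains c (hk ▸ hn) hinj h6 hD' φ, RE_dsE_im_eq_zero_of_ker_le_cubeDomains c (hk ▸ hn) hinj h6 hD' φ⟩⟩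

/-- ★★ **THE DOOR AT THE PRINT DATUM `𝔔 = propCubeP P n hn M ρ hρ a` OF A GRID CUBE, FROM `GaugedBoundB8` AT THE DATUM, WITH (153) AT EVERY KERNEL-FINER FAMILY** —
generation 3's `exists_localGauge152_RE153_coverBox_propCubeP_of_gaugedBoundB8` (window `π(𝔔) = cover P '' box L (propCubeP …).a (propCubeP …).M n`; non-wrapping displayed
as `Set.InjOn (cover P) (cube L (propCubeP …).a (propCubeP …).M (propCubeP …).ρ n 0)`) with the sixth clause over every `D′` with `ker Q′_{D′} ≤ ker Q′_{cubeDomains 𝔔}`.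
[cite: Balaban1985Variational, (144) p.300, (150)–(153) p.301; Balaban1985RegularSpaces, Prop. 6 (1.135)–(1.138) p.99, (1.38) p.82; Balaban1984PropagatorsII, (2.12) p.225; Balaban1987RG1, (0.1) p.251] -/
theorem exists_localGauge152_REfiner153_coverBox_propCubeP_of_gaugedBoundB8 (hd : 2 ≤ P.d) {n : ℕ} (hn : 1 ≤ n) (hnK : n ≤ P.m + P.K)
    {M ρ : ℕ} (hρ : P.L ≤ ρ) (a : Pt P.d) (U : GaugeField P 0 (SU N))
    (hinj : Set.InjOn (cover P)
      (cube P.L (propCubeP P n hn M ρ hρ a).a (propCubeP P n hn M ρ hρ a).M (propCubeP P n hn M ρ hρ a).ρ n 0))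
    {r : ℝ} (hr : 0 ≤ r)
    (hG : letI : CStarAlgebra (MatA N) := {}; GaugedBoundB8 P.L (P.eta n) (zdLift N U) (propCubeP P n hn M ρ hρ a) r)
    (h2π : (2 * boxWidth (bLo P.L (propCubeP P n hn M ρ hρ a).a n 0) (bHi P.L (propCubeP P n hn M ρ hρ a).a (propCubeP P n hn M ρ hρ a).M n 0) + 1) *
        (P.eta n * N * (r * ((P.L : ℝ) ^ n * P.eta n)⁻¹)) < 2 * Real.pi) :
    ∃ u : GaugeTransf P 0 (SU N), ∃ A : PBond P 0 → MatA N,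
      (∀ b ∈ (Sect2.regionOfSet P (cover P '' box P.L (propCubeP P n hn M ρ hρ a).a (propCubeP P n hn M ρ hρ a).M n)).bonds,
          gaugeU (fun x => ιSU N (u x)) (fun b' => ιSU N (U b')) b = expI (P.eta n) (A b)) ∧
      (∀ b ∈ (Sect2.regionOfSet P (cover P '' box P.L (propCubeP P n hn M ρ hρ a).a (propCubeP P n hn M ρ hρ a).M n)).bonds, ‖A b‖ ≤ 2 * r) ∧
      (∀ q ∈ (Sect2.regionOfSet P (cover P '' box P.L (propCubeP P n hn M ρ hρ a).a (propCubeP P n hn M ρ hρ a).M n)).dpairs,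
          ‖grad (P.eta n) q.2.1 (fun y => A ⟨y, q.2.2⟩) q.1‖ ≤ 2 * r) ∧
      (∀ b ∈ Sect2.bondsDeep (cover P '' box P.L (propCubeP P n hn M ρ hρ a).a (propCubeP P n hn M ρ hρ a).M n),
          ‖Sect2.codiffCurlA (P.eta n) A b.src b.dir‖ ≤ 2 * r) ∧
      (∀ b ∈ Sect2.bondsDeep (cover P '' box P.L (propCubeP P n hn M ρ hρ a).a (propCubeP P n hn M ρ hρ a).M n),
          ‖∑ ν : Fin P.d, ((P.eta n : ℝ) : ℂ)⁻¹ •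
              (grad (P.eta n) ν (fun y => A ⟨y, b.dir⟩) (b.src.unshift ν) - grad (P.eta n) ν (fun y => A ⟨y, b.dir⟩) b.src)‖ ≤ 2 * r) ∧
      (∀ D' : Domains P, LinearMap.ker (QpE D') ≤ LinearMap.ker (QpE (cubeDomains P (propCubeP P n hn M ρ hρ a).a (propCubeP P n hn M ρ hρ a).M ρ n hnK)) →
        ∀ φ : MatA N →L[ℂ] ℂ,
          RE D' (P.eta n)⁻¹ (dsE (P.eta n)⁻¹ (WithLp.toLp 2 fun b => (φ (A b)).re : BondSpace P)) = 0 ∧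
          RE D' (P.eta n)⁻¹ (dsE (P.eta n)⁻¹ (WithLp.toLp 2 fun b => (φ (A b)).im : BondSpace P)) = 0) :=
  exists_localGauge152_REfiner153_box_of_gaugedBoundB8 hd (propCubeP P n hn M ρ hρ a) U (propCubeP_k P n hn M ρ hρ a) hnK
    (by rw [CubeB8.sq_zero_eq_cube]; exact hinj) hr hG h2π

/-- ★★★ **THE BOUNDARY-DATUM DOOR: THE PRINT DATUM FROM [6] PROPOSITION 6 ON PRINT'S CUBE CLASS AT NODE 00's `ℤᵈ` MEMBER, WITH (153) AT EVERY KERNEL-FINER FAMILY** —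
generation 3's `exists_localGauge152_RE153_coverBox_propCubeP_of_prop6P` (hypotheses BYTE FOR BYTE: `d ≥ 2`; `B8.Prop6Printed d L B₁ c₁ (zdCubP (M_N ℂ) L ρ₀ ·)` — the
HYPOTHESIS, [6] Prop. 6 on print's class, applied to the CUBE datum; `ρ₀ ∣ ρ`, `L ≤ ρ`; the (1.7)∕(1.9)-Top class of `U` at levels `≤ kT`; `1 ≤ n ≤ kT + 1`, `n ≤ m + K`,
`0 < ε_{n−1}`; the non-wrapping of the datum's collared cube; the collar `hcollar : π((cubeIdxP' …).Ω 0) ⊆ Ω_{n−1}` (resp. `Ω₀` at `n = 1`) — the hypothesis the S6 head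
discharges at a boundary datum from a `Within`-witness; «7dL²M′α₀ ≤ c₁», `α₀ = L³ε_{n−1}`; the `2π`-window) with the sixth clause over every `D′` with
`ker Q′_{D′} ≤ ker Q′_{cubeDomains 𝔔}` — at a boundary datum instantiate `D′ :=` the levelwise meet `□_j ∩ Ω_j` of (150) and discharge the inclusion by the order
`D′ ≤ cubeDomains 𝔔` (dag-n07-e's `ker_QpE_le_of_domainsLe` ∘ `domainsMeet_le_left`).  `r = 7dL²B₁M′·L³ε_{n−1}`, `M′ = sideP P M ρ`; the derivation of `GaugedBoundB8` at the datum is generation 0's, verbatim.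
[cite: Balaban1985Variational, (144)–(153) pp.300–301, Thm 1 (9)–(10) p.279; Balaban1985RegularSpaces, Prop. 6 (1.135)–(1.138) p.99, p.98, (1.7) p.77, (1.38) p.82; Balaban1984PropagatorsII, (2.10)–(2.12) p.225] -/
theorem exists_localGauge152_REfiner153_coverBox_propCubeP_of_prop6P (hd : 2 ≤ P.d) {B₁ c₁ : ℝ} (hB₁ : 0 ≤ B₁) {ρ₀ ρ : ℕ} (hρ₀ : ρ₀ ∣ ρ) (hρ : P.L ≤ ρ)
    (hP6 : letI : CStarAlgebra (MatA N) := {}; B8.Prop6Printed P.d (P.L : ℝ) B₁ c₁ (fun i : ZdIdx P.d P.L => zdCubP (MatA N) P.L ρ₀ i))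
    {Ω : ℕ → Set (Site P 0)} {Ω₀ : Set (Site P 0)} {kT : ℕ} {ε : ℕ → ℝ} (U : GaugeField P 0 (SU N))
    (hP : ∀ m, m ≤ kT → PlaqSmallOn (Sect2.omegaPlaqsTop Ω Ω₀ m) (ε m * P.eta m ^ 2) U)
    (hD : ∀ m, m ≤ kT → Sect2.CoDivSmallOn (Sect2.omegaBondsTop Ω Ω₀ m) (ε m * P.eta m ^ 3) U)
    {n : ℕ} (hn : 1 ≤ n) (hnk : n ≤ kT + 1) (hnK : n ≤ P.m + P.K) (hε : 0 < ε (n - 1)) {M : ℕ} (a : Pt P.d)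
    (hinj : Set.InjOn (cover P)
      (cube P.L (propCubeP P n hn M ρ hρ a).a (propCubeP P n hn M ρ hρ a).M (propCubeP P n hn M ρ hρ a).ρ n 0))
    (hcollar : cover P '' (cubeIdxP' P n hn M ρ a).Ω 0 ⊆ (if n - 1 = 0 then Ω₀ else Ω (n - 1)))
    (hc₁ : 7 * P.d * (P.L : ℝ) ^ 2 * (propCubeP P n hn M ρ hρ a).M * ((P.L : ℝ) ^ 3 * ε (n - 1)) ≤ c₁)
    (h2π : (2 * boxWidth (bLo P.L (propCubeP P n hn M ρ hρ a).a n 0) (bHi P.L (propCubeP P n hn M ρ hρ a).a (propCubeP P n hn M ρ hρ a).M n 0) + 1) *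
        (P.eta n * N * (7 * P.d * (P.L : ℝ) ^ 2 * B₁ * (propCubeP P n hn M ρ hρ a).M * ((P.L : ℝ) ^ 3 * ε (n - 1)) *
          ((P.L : ℝ) ^ n * P.eta n)⁻¹)) < 2 * Real.pi) :
    ∃ u : GaugeTransf P 0 (SU N), ∃ A : PBond P 0 → MatA N,
      (∀ b ∈ (Sect2.regionOfSet P (cover P '' box P.L (propCubeP P n hn M ρ hρ a).a (propCubeP P n hn M ρ hρ a).M n)).bonds,
          gaugeU (fun x => ιSU N (u x)) (fun b' => ιSU N (U b')) b = expI (P.eta n) (A b)) ∧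
      (∀ b ∈ (Sect2.regionOfSet P (cover P '' box P.L (propCubeP P n hn M ρ hρ a).a (propCubeP P n hn M ρ hρ a).M n)).bonds,
          ‖A b‖ ≤ 2 * (7 * P.d * (P.L : ℝ) ^ 2 * B₁ * (propCubeP P n hn M ρ hρ a).M * ((P.L : ℝ) ^ 3 * ε (n - 1)))) ∧
      (∀ q ∈ (Sect2.regionOfSet P (cover P '' box P.L (propCubeP P n hn M ρ hρ a).a (propCubeP P n hn M ρ hρ a).M n)).dpairs,
          ‖grad (P.eta n) q.2.1 (fun y => A ⟨y, q.2.2⟩) q.1‖ ≤ 2 * (7 * P.d * (P.L : ℝ) ^ 2 * B₁ * (propCubeP P n hn M ρ hρ a).M * ((P.L : ℝ) ^ 3 * ε (n - 1)))) ∧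
      (∀ b ∈ Sect2.bondsDeep (cover P '' box P.L (propCubeP P n hn M ρ hρ a).a (propCubeP P n hn M ρ hρ a).M n),
          ‖Sect2.codiffCurlA (P.eta n) A b.src b.dir‖ ≤ 2 * (7 * P.d * (P.L : ℝ) ^ 2 * B₁ * (propCubeP P n hn M ρ hρ a).M * ((P.L : ℝ) ^ 3 * ε (n - 1)))) ∧
      (∀ b ∈ Sect2.bondsDeep (cover P '' box P.L (propCubeP P n hn M ρ hρ a).a (propCubeP P n hn M ρ hρ a).M n),
          ‖∑ ν : Fin P.d, ((P.eta n : ℝ) : ℂ)⁻¹ •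
              (grad (P.eta n) ν (fun y => A ⟨y, b.dir⟩) (b.src.unshift ν) - grad (P.eta n) ν (fun y => A ⟨y, b.dir⟩) b.src)‖ ≤
            2 * (7 * P.d * (P.L : ℝ) ^ 2 * B₁ * (propCubeP P n hn M ρ hρ a).M * ((P.L : ℝ) ^ 3 * ε (n - 1)))) ∧
      (∀ D' : Domains P, LinearMap.ker (QpE D') ≤ LinearMap.ker (QpE (cubeDomains P (propCubeP P n hn M ρ hρ a).a (propCubeP P n hn M ρ hρ a).M ρ n hnK)) →
        ∀ φ : MatA N →L[ℂ] ℂ,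
          RE D' (P.eta n)⁻¹ (dsE (P.eta n)⁻¹ (WithLp.toLp 2 fun b => (φ (A b)).re : BondSpace P)) = 0 ∧
          RE D' (P.eta n)⁻¹ (dsE (P.eta n)⁻¹ (WithLp.toLp 2 fun b => (φ (A b)).im : BondSpace P)) = 0) := by
  letI : CStarAlgebra (MatA N) := {}
  have hηpos : 0 < P.eta n := B3GkZeroTorusRescaled.eta_pos P n
  -- the member, the datum, the lift in the class (generation 0's derivation, verbatim)
  set i : ZdIdx P.d P.L := cubeIdxP' P n hn M ρ a with hi
  set c := propCubeP P n hn M ρ hρ a with hc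
  set α : ℝ := (P.L : ℝ) ^ 3 * ε (n - 1) with hα
  have hαpos : 0 < α := mul_pos (pow_pos (by exact_mod_cast P.L_pos) 3) hε
  have hInAk : InAk P.L i.k i.η α i.Ω (zdLift N U) :=
    inAk_zdLift_of_top U hP hD hηpos (lvl := fun _ => n - 1) (fun j _ => by omega) (fun j _ => hcollar)
      (fun j hj => (tol_of_level_pred P hn hε.le hj).1) (fun j hj => (tol_of_level_pred P hn hε.le hj).2)
  have hVU : ∀ x κ, zdLift N U x κ ∈ unitaryUnits (MatA N) := fun x κ => zdLift_mem_unitaryUnits U x κ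
  -- [6] Proposition 6 ON PRINT'S CLASS at the member and the (print) datum: the HYPOTHESIS `hP6`, instantiated
  have hprint : c.IsPrint ρ₀ := (isPrint_propCubeP P n hn M ρ hρ a).of_dvd hρ₀
  have hG : GaugedBoundB8 P.L i.η (zdLift N U) c (7 * P.d * (P.L : ℝ) ^ 2 * B₁ * c.M * α) :=
    (prop6Printed_zdCubP_iff (fun i : ZdIdx P.d P.L => i) ρ₀ B₁ c₁).1 hP6 i α hαpos ⟨zdLift N U, hVU⟩ hInAk c hprint hc₁
  have hr0 : 0 ≤ 7 * P.d * (P.L : ℝ) ^ 2 * B₁ * c.M * α := by positivity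
  exact exists_localGauge152_REfiner153_coverBox_propCubeP_of_gaugedBoundB8 hd hn hnK hρ a U hinj hr0 hG h2π

end Capstones

end Literature.MathematicalPhysics.QuantumFieldTheory.Balaban1983to89.Node00

end
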